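import Summits.CriticalPhenomena.CardyFormulaZ2.Theorems.CardyBoundaryCoulombGasAssembly
import Summits.CriticalPhenomena.CardyFormulaZ2.Theorems.CardyBoundaryCoulombGasRectilinearCardyDensityIntegration
import Summits.CriticalPhenomena.CardyFormulaZ2.Theorems.CardyBoundaryCoulombGasBoundaryDefectGaussianRHardness
import HarnessLib

/-!
# Crux `BoundaryDefectGaussianR` (stmt-CriticalPhenomena-14132) is summit-complete for `CardyFormulaZ2`

Lead seat c5 of line `rainbow-monomials-in-excursion-kernels`. Two landed glue theorems of route
`CardyBoundaryCoulombGas` — `DensityIntegration_proof : BoundaryDefectGaussianR → RectilinearCardy`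
(stmt-CriticalPhenomena-14890) and `RectilinearSuffices_proof : RectilinearCardy → CardyFormulaZ2`
(stmt-CriticalPhenomena-5663) — compose to `BoundaryDefectGaussianR → CardyFormulaZ2`: the engine crux ALONE
already yields the sub-problem (Cardy's formula for critical bond percolation on `ℤ²` in every conformal
rectangle). Together with seat c4's certificate `halfPlaneOneArmThird_of_boundaryDefectGaussianR`
(`…BoundaryDefectGaussianRHardness`), this records in one place why no line of the crux can close before the
open cruxes it dominates: any proof of `BoundaryDefectGaussianR` is simultaneously a proof of `CardyFormulaZ2`
and of `HalfPlaneOneArmThird` (stmt-CriticalPhenomena-5662). Pure composition; no new mathematics.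
-/

namespace Summit.CriticalPhenomena.CardyFormulaZ2.Cruxes.BoundaryDefectGaussianR.RainbowMonomialsInExcursionKernels

/-- **Summit-completeness of the crux.** `BoundaryDefectGaussianR → CardyFormulaZ2`, by composing the landed
route glue `DensityIntegration_proof` (the `(1,1,1;3)` member of the crux is the wired-arc mark density of every
rectilinear polygon; summed along the boundary it gives `RectilinearCardy`) with `RectilinearSuffices_proof`
(rectilinear conformal rectangles suffice, by Carathéodory-kernel approximation). [folklore] -/
theorem cardyFormulaZ2_of_boundaryDefectGaussianR :
    Summit.CriticalPhenomena.CardyFormulaZ2.Theses.CardyBoundaryCoulombGas.BoundaryDefectGaussianR →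
      _root_.CardyFormulaZ2 :=
  fun h ↦ Summit.CriticalPhenomena.CardyFormulaZ2.Theorems.RectilinearSuffices_proof
    (Summit.CriticalPhenomena.CardyFormulaZ2.Theorems.DensityIntegration_proof h)

/-- **What any proof of the crux proves.** `BoundaryDefectGaussianR` implies both the sub-problem
`CardyFormulaZ2` (previous theorem) and crux 6 of the route, `HalfPlaneOneArmThird` (the half-plane one-arm
exponent `1/3` of bond percolation on `ℤ²`; seat c4's certificate
`halfPlaneOneArmThird_of_boundaryDefectGaussianR`). [folklore] -/
theorem cardyFormulaZ2_and_halfPlaneOneArmThird_of_boundaryDefectGaussianR :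
    Summit.CriticalPhenomena.CardyFormulaZ2.Theses.CardyBoundaryCoulombGas.BoundaryDefectGaussianR →
      _root_.CardyFormulaZ2 ∧
        Summit.CriticalPhenomena.CardyFormulaZ2.Theses.CardyBoundaryCoulombGas.HalfPlaneOneArmThird :=
  fun h ↦ ⟨cardyFormulaZ2_of_boundaryDefectGaussianR h, halfPlaneOneArmThird_of_boundaryDefectGaussianR h⟩

end Summit.CriticalPhenomena.CardyFormulaZ2.Cruxes.BoundaryDefectGaussianR.RainbowMonomialsInExcursionKernels
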